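import Mathlib
import HarnessLib
import Summits.HubbardSuperconductivity.HubbardSuperconductivity.Theorems.KLProgrammeKLRegimeEngineTowerBlockIncrWtPowAtKitCarrier
import Summits.HubbardSuperconductivity.HubbardSuperconductivity.Theorems.KLProgrammeKLRegimeEngineTowerBlockIncrWtKitUnits

/-!
# Route `KLProgramme` — crux K3 ENGINE (stmt-HubbardSuperconductivity-20437 `KLRegimeEngineV17F2`), stub (b) / E1 interface (E2) in-tower route and located risk #17
# «(C2)-MOMENTS»: THE DEGREE-`Dw` MODEL Hstep IN THE KIT'S DIMENSIONLESS FORM — the carriers `klTowerBornWtPowAt / klTowerMeasWtPowAt` divided by units,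
# for ANY unit pair `(u, Kc)`; the power-`Dw` twin of `…EngineTowerBlockIncrWtKitUnits` §2
# (recipe «(E2)-POW3-TRACK» item T5/T6 «link», HOME/hubbard-kl-k3c3-p2/g19/E2-POW3-TRACK-RECIPE.md; pen g27 (R472)(D) carriers/link GO, (R479) «LINK/LAW twins»;
#  cell gate-hubbard-kl, seat hubbard-kl-k3c3-p2 g20)

`klTowerBornWtPowAt_le_kit` (✓ …TowerBlockIncrWtPowAtKitCarrier) bounds the degree-`Dw` born carrier by `ε^{2q+1}·cr·cc^{2q+1}·KitRHS_abs(N)` with ABSOLUTE input sizes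
`N m′ = ε·klTowerMeasWtPowAt … Dw (2m′)`.  For any unit pair `(u, Kc)` put the sizes in the kit's form `N m = (ε·Kc)·(u^m·μ m)` with the DIMENSIONLESS measured array
`μ m := klTowerMeasWtPowAt … Dw (2m)/(Kc·u^m)` (`towerInputSizes_units`); `kitStep_abs_eq_units_mul` (…TowerBlockIncrWtKitUnits §1) rewrites
`KitRHS_abs(N) = (u^p·εKc)·kitRHS(μ; σu, τu, Φ·εKc, ψ/u)` and the prefactor collects into `(ε·cr)·(ε·cc)^{2q+1}·(u^{q+1}·Kc)`:

* **`klTowerBornWtPowAt_le_kit_units (j Dw)`** — `klTowerBornWtPowAt … d k j Dw (2(q+1)) ≤ (ε·cr)·(ε·cc)^{2q+1}·(u^{q+1}·Kc)·[towerFO D (κ²u) μ (q+1) +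
  Σ_{n∈Icc 2 (N₀−1)} e·(Φ̂)^{n−1}·(ψ̂)^{q+1}·towerS D (τu) μ n (q+1) + ψ̂^{q+1}·e·towerV D (τu) μ·(Φ̂·towerV D (τu) μ)^{N₀−1}/(1 − Φ̂·towerV D (τu) μ)]` with
  `Φ̂ = (eα/κ²)·(ε·Kc)`, `ψ̂ = ρ⁻²/u`, `τ = (e²(κ+ρ))²` — the `hstep` shape of the kit's laws for the born array `klTowerBornWtPowAt … (2p)/((ε·cr)·(ε·cc)^{2p−1}·u^p·Kc)`.
The weights are dimensionless, so the units bookkeeping is degree-1's VERBATIM.  The window-free flow-frame form (§3 of the degree-1 file) is NOT twinned: it reads the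
degree-`Dw` weighted decay / overlap SUPPLIER rows (recipe T3/T4), which are not typed (pen g27 (R465)(E)(iii) STOP RULE, (R477)).
Composition of landed theorems; block constants (`κ`, degree-`Dw` weighted `α`, `cr/cc`) are HYPOTHESES; nothing asserts (E2), (X).3, any stub, K3 or superconductivity.
References: BGM 2006 §2.8 (2.83), §3 (3.2)–(3.8) [cite: BenfattoGiulianiMastropietro2006]; Gawȩdzki–Kupiainen 1985 §3.
-/

noncomputable section

namespace Summit.HubbardSuperconductivity.HubbardSuperconductivity.Theorems.EngineV8

set_option linter.dupNamespace false -- summit = problem name (single-conjunct summit), D-0017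

open Real Finset Literature.MathematicalPhysics.QuantumLattice Literature.Probability.LatticeModels GrassmannAlgebra
open Literature.MathematicalPhysics.QuantumLattice.BandSectorCounting
open Summit.HubbardSuperconductivity.HubbardSuperconductivity.Theorems.KLProgrammeLegKernels
open Summit.HubbardSuperconductivity.HubbardSuperconductivity.Theorems.KLRegimeSplit
open Summit.HubbardSuperconductivity.HubbardSuperconductivity.Theorems.KLRegimeWick
open Summit.HubbardSuperconductivity.HubbardSuperconductivity.Theorems.TwoPointAssembly
open Summit.HubbardSuperconductivity.HubbardSuperconductivity.Theorems.TorusFourierL2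
open Summit.HubbardSuperconductivity.HubbardSuperconductivity.Theorems.DispersionFlow
open Literature.Probability.LatticeModels.BattleFederbush

variable {L M : ℕ} [NeZero L]

/-! ## §1 The degree-`Dw` model Hstep in the kit's dimensionless form — binder version -/

section Born

variable [NeZero M]

/-- **THE DEGREE-`Dw` MODEL Hstep IN THE KIT'S DIMENSIONLESS FORM, ANY UNITS `(u, Kc)`.**  Binders as `klTowerBornWtPowAt_le_kit` (✓ …TowerBlockIncrWtPowAtKitCarrier);
with `μ m := klTowerMeasWtPowAt … d k j Dw (2m)/(Kc·u^m)`: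
`klTowerBornWtPowAt … d k j Dw (2(q+1)) ≤ (ε·cr)·(ε·cc)^{2q+1}·(u^{q+1}·Kc)·[towerFO D (κ²u) μ (q+1) + Σ e·Φ̂^{n−1}·ψ̂^{q+1}·towerS D (τu) μ n (q+1) + ψ̂^{q+1}·e·V̂·(Φ̂V̂)^{N₀−1}/(1−Φ̂V̂)]`,
`τ = (e²(κ+ρ))²`, `Φ̂ = (eα/κ²)·(ε·Kc)`, `ψ̂ = ρ⁻²/u`, `V̂ = towerV D (τu) μ` — i.e. `hstep` of the kit's laws for the born array
`klTowerBornWtPowAt … (2p)/((ε·cr)(ε·cc)^{2p−1}u^p Kc)` at the constants `(κ²u, τu, Φ̂, ψ̂)`. [cite: BenfattoGiulianiMastropietro2006, §2.8 (2.83), §3 (3.2)-(3.8)] -/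
theorem klTowerBornWtPowAt_le_kit_units {β : ℝ} (hβ : 0 < β) (U μ : ℝ) (K : TrigPolyC4v) {d k : ℕ} (j Dw : ℕ) (hd : 1 ≤ d) (hk : 1 ≤ k)
    (hZ : hubbardEffPartitionFnCT L M β U μ 0 K (klScale klE0 (d * k)) ≠ 0)
    {κ : ℝ} (hκ : 0 < κ)
    (hGB : IsGramBoundedR ((sectorSubMatrix L M β (bgmFatMultiplier L M klE0 β (nambuXiCT L μ K) (d * k - 1))).transpose *
      hubbardCovSliceCT L M β μ 0 K (klScale klE0 (d * (k + 1))) (klScale klE0 (d * k)) *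
        sectorSubMatrix L M β (bgmFatMultiplier L M klE0 β (nambuXiCT L μ K) (d * k - 1))) κ)
    {α : ℝ} (hα : 0 < α)
    (hrow : ∀ X, ∑ Y, ‖((sectorSubMatrix L M β (bgmFatMultiplier L M klE0 β (nambuXiCT L μ K) (d * k - 1))).transpose *
        hubbardCovSliceCT L M β μ 0 K (klScale klE0 (d * (k + 1))) (klScale klE0 (d * k)) *
          sectorSubMatrix L M β (bgmFatMultiplier L M klE0 β (nambuXiCT L μ K) (d * k - 1))) X Y‖ *
        klScaleWtPow L M β j Dw {latticeLegPos (2 * (2 * M)) X, latticeLegPos (2 * (2 * M)) Y} ≤ α)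
    (hcol : ∀ Y, ∑ X, ‖((sectorSubMatrix L M β (bgmFatMultiplier L M klE0 β (nambuXiCT L μ K) (d * k - 1))).transpose *
        hubbardCovSliceCT L M β μ 0 K (klScale klE0 (d * (k + 1))) (klScale klE0 (d * k)) *
          sectorSubMatrix L M β (bgmFatMultiplier L M klE0 β (nambuXiCT L μ K) (d * k - 1))) X Y‖ *
        klScaleWtPow L M β j Dw {latticeLegPos (2 * (2 * M)) X, latticeLegPos (2 * (2 * M)) Y} ≤ α)
    {ρ : ℝ} (hρ : 0 < ρ) {D : ℕ} (hD : Fintype.card (SpaceTimeIdx L M × SectorLeg (sectorCount (d * k - 1))) / 2 ≤ D)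
    (hguard : Real.exp 1 * α / κ ^ 2 *
      towerV D ((Real.exp 2 * (κ + ρ)) ^ 2) (fun m' => imagTimeWeight β M * klTowerMeasWtPowAt L M β U μ K d k j Dw (2 * m')) < 1)
    {cr cc : ℝ} (hcr0 : 0 ≤ cr) (hcc0 : 0 ≤ cc)
    (hrow' : ∀ X'', ∑ X', ‖(sectorAnalysisMatrix L M β (klAnisoFamily L M β μ K klE0 (d * k)) *
        sectorSubMatrix L M β (bgmFatMultiplier L M klE0 β (nambuXiCT L μ K) (d * k - 1))) X'' X'‖ *
        klScaleWtPow L M β j Dw {latticeLegPos (2 * (2 * M)) X'', latticeLegPos (2 * (2 * M)) X'} ≤ cr)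
    (hcol' : ∀ X', ∑ X'', ‖(sectorAnalysisMatrix L M β (klAnisoFamily L M β μ K klE0 (d * k)) *
        sectorSubMatrix L M β (bgmFatMultiplier L M klE0 β (nambuXiCT L μ K) (d * k - 1))) X'' X'‖ *
        klScaleWtPow L M β j Dw {latticeLegPos (2 * (2 * M)) X'', latticeLegPos (2 * (2 * M)) X'} ≤ cc)
    {N₀ : ℕ} (hN₀ : 2 ≤ N₀) (q : ℕ) {u Kc : ℝ} (hu : 0 < u) (hKc : 0 < Kc) :
    klTowerBornWtPowAt L M β U μ K d k j Dw (2 * (q + 1)) ≤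
      (imagTimeWeight β M * cr) * (imagTimeWeight β M * cc) ^ (2 * q + 1) * (u ^ (q + 1) * Kc) *
        (towerFO D (κ ^ 2 * u) (fun m => klTowerMeasWtPowAt L M β U μ K d k j Dw (2 * m) / (Kc * u ^ m)) (q + 1) +
          ∑ n ∈ Icc 2 (N₀ - 1), Real.exp 1 * (Real.exp 1 * α / κ ^ 2 * (imagTimeWeight β M * Kc)) ^ (n - 1) * (ρ⁻¹ ^ 2 / u) ^ (q + 1) *
            towerS D ((Real.exp 2 * (κ + ρ)) ^ 2 * u) (fun m => klTowerMeasWtPowAt L M β U μ K d k j Dw (2 * m) / (Kc * u ^ m)) n (q + 1) +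
          (ρ⁻¹ ^ 2 / u) ^ (q + 1) * Real.exp 1 *
            towerV D ((Real.exp 2 * (κ + ρ)) ^ 2 * u) (fun m => klTowerMeasWtPowAt L M β U μ K d k j Dw (2 * m) / (Kc * u ^ m)) *
            (Real.exp 1 * α / κ ^ 2 * (imagTimeWeight β M * Kc) *
              towerV D ((Real.exp 2 * (κ + ρ)) ^ 2 * u) (fun m => klTowerMeasWtPowAt L M β U μ K d k j Dw (2 * m) / (Kc * u ^ m))) ^ (N₀ - 1) /
            (1 - Real.exp 1 * α / κ ^ 2 * (imagTimeWeight β M * Kc) *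
              towerV D ((Real.exp 2 * (κ + ρ)) ^ 2 * u) (fun m => klTowerMeasWtPowAt L M β U μ K d k j Dw (2 * m) / (Kc * u ^ m)))) := by
  have hε := imagTimeWeight_pos_of_pos (M := M) hβ
  have h := klTowerBornWtPowAt_le_kit (L := L) (M := M) hβ U μ K j Dw hd hk hZ hκ hGB hα hrow hcol hρ hD hguard hcr0 hcc0 hrow' hcol' hN₀ q
  have hN := towerInputSizes_units (ε := imagTimeWeight β M) hu.ne' hKc.ne' (fun m => klTowerMeasWtPowAt L M β U μ K d k j Dw m)
  rw [hN] at h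
  rw [kitStep_abs_eq_units_mul (mul_ne_zero hε.ne' hKc.ne') hu.ne'] at h
  refine h.trans (le_of_eq ?_)
  ring

end Born

end Summit.HubbardSuperconductivity.HubbardSuperconductivity.Theorems.EngineV8

end
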